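import Literature.NumberTheory.Sieve.QuadraticRootsLevelClasses
import Mathlib.Analysis.Complex.UpperHalfPlane.MoebiusAction
import Mathlib.NumberTheory.Pell
import HarnessLib

/-!
# Level forms in the upper half-plane: Heegner points (`Δ < 0`) and geodesics (`Δ > 0`)

Topic `Literature/NumberTheory/Sieve`, fourth file of the arithmetic trunk common to W. Duke,
J. B. Friedlander, H. Iwaniec, Ann. of Math. 141 (1995), §2 and Á. Tóth, IMRN 2000
(`QuadraticRootsLevelForms.lean`, `QuadraticRootsLevelCosets.lean`, `QuadraticRootsLevelClasses.lean`).  DFI identify the forms `(α, β, γ)` of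
determinant `D > 0` with the points `z = (−β + i√D)/α ∈ ℍ` through the equivariant map `π` of
§2 p. 427 ("these actions commute"), so that the forms of a class become the points `σz`,
`σ ∈ Γ_z∖Γ`, and the class sums become values of Poincaré series (14); for positive discriminant
(Tóth) the point is replaced by the geodesic joining the two real roots.  This file proves the
equivariance underlying both, for the tree's integral forms `Q = [A, B, C]` acted on by
`SL₂(ℤ)` on the right (`RootForms.smul`) and Mathlib's action of `SL(2, ℤ)` on `ℍ`:

* `RootForms.evalC Q z = Az² + Bz + C` and **`evalC_smul`**:
  `(Q·γ)(z) = (cz + d)² · Q(γz)` — so the zeros move by `γ⁻¹`;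
* `Δ < 0`: the **Heegner point** `heegnerPt Q = (−B + i√|Δ|)/(2A)` of a form with `A > 0`, the
  unique zero of `Q(z, 1)` in `ℍ` (`evalC_heegnerPt`, `eq_heegnerPt_of_evalC_eq_zero`), and
  **`heegnerPt_smul : heegnerPt (Q·γ) = γ⁻¹ • heegnerPt Q`** (DFI's `π ∘ σ = σ ∘ π`); the
  stabiliser of a definite form is finite (`finite_stab_of_definite`, the `Γ_z` of (13), so that
  `ncard_fibre_eq` of `…LevelClasses` applies);
* `Δ > 0`: `RootForms.herm Q z = A|z|² + B Re z + C` and **`herm_smul`**: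
  `herm (Q·γ) z = |cz + d|² herm Q (γz)`; the **geodesic** `geod Q = {z ∈ ℍ : herm Q z = 0}` is the
  semicircle `(x + B/2A)² + y² = Δ/(4A²)` (`herm_eq_mul`, `mem_geod_iff`) and
  **`mem_geod_smul_iff : z ∈ geod (Q·γ) ↔ γ • z ∈ geod Q`**; the **automorphs**
  `automorph Q : Pell.Solution₁ Δ →* SL₂(ℤ)` (`(x, y) ↦ (x − By, −2Cy; 2Ay, x + By)`) land in
  `stab Q` injectively, so `stab Q` is infinite for non-square `Δ > 0` (`infinite_stab_of_pos`) —
  the closed-geodesic structure of the positive-discriminant case.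

Everything here is proved; nothing of either paper is vendored.

## References

* W. Duke, J. B. Friedlander, H. Iwaniec, Ann. of Math. (2) 141 (1995), 423–441, §2 p. 427 (the
  map `π`, "these actions commute", the classes `Λ` and stability groups `Γ_z`).
  [cite: DukeFriedlanderIwaniec1995, §2 p. 427]
* Á. Tóth, *Roots of quadratic congruences*, IMRN 2000, no. 14, 719–739 (positive discriminant:
  closed geodesics; cite-only in the store, cf. [cite: Ngo2024, §1]). [cite: Toth2000, main theorem]
* D. A. Cox, *Primes of the form x² + ny²*, 2nd ed. (2013), §2.A (positive definite forms,
  `eval_pos` of the tree's `BinQF`) and §7.B, Thm. 7.7 (the root `(−b + √D)/2a ∈ ℍ` attached to a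
  positive definite form). [cite: Cox2013, §7.B Thm. 7.7]
* The automorphs `x·1 + y·M` of an indefinite form from the Pell equation are classical
  (Lagrange–Gauss–Dirichlet); here they are simply verified by computation. [folklore]
-/

noncomputable section

namespace Literature.NumberTheory.Sieve

open scoped MatrixGroups UpperHalfPlane
open Literature.NumberTheory.QuadraticFields.Quadratic (BinQF)
open UpperHalfPlane

namespace RootForms

/-! ### `Q(z, 1)` and its transformation under `SL₂(ℤ)` -/

/-- `Q(z, 1) = Az² + Bz + C` for complex `z`. [cite: DukeFriedlanderIwaniec1995, §2 p. 427] -/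
def evalC (Q : BinQF) (z : ℂ) : ℂ := Q.a * z ^ 2 + Q.b * z + Q.c

/-- **`(Q·γ)(z, 1) = (cz + d)² Q(γz, 1)`** for `γ = (a b; c d)`, `cz + d ≠ 0`.
[cite: DukeFriedlanderIwaniec1995, §2 p. 427 ("these actions commute")] -/
theorem evalC_smul_of_ne_zero (Q : BinQF) (γ : SL(2, ℤ)) {z : ℂ}
    (hd : ((γ 1 0 : ℤ) : ℂ) * z + ((γ 1 1 : ℤ) : ℂ) ≠ 0) :
    evalC (smul Q γ) z = (((γ 1 0 : ℤ) : ℂ) * z + ((γ 1 1 : ℤ) : ℂ)) ^ 2 *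
      evalC Q ((((γ 0 0 : ℤ) : ℂ) * z + ((γ 0 1 : ℤ) : ℂ)) /
        (((γ 1 0 : ℤ) : ℂ) * z + ((γ 1 1 : ℤ) : ℂ))) := by
  simp only [evalC, smul, BinQF.act]
  push_cast
  field_simp
  ring

/-- The denominator `cz + d` of `γ ∈ SL₂(ℤ)` at `z ∈ ℍ` is non-zero. [folklore] -/
theorem denomZ_ne_zero (γ : SL(2, ℤ)) (z : ℍ) :
    ((γ 1 0 : ℤ) : ℂ) * z + ((γ 1 1 : ℤ) : ℂ) ≠ 0 := by
  intro h
  have him := congrArg Complex.im h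
  simp only [Complex.add_im, Complex.mul_im, Complex.intCast_re, Complex.intCast_im, zero_mul,
    add_zero, Complex.zero_im, UpperHalfPlane.coe_im] at him
  -- `γ₁₀ · Im z = 0`
  have hz : (0 : ℝ) < z.im := z.im_pos
  have h10 : (γ 1 0 : ℤ) = 0 := by
    have : ((γ 1 0 : ℤ) : ℝ) = 0 := by
      rcases mul_eq_zero.1 him with h' | h'
      · exact h'
      · exact absurd h' hz.ne'
    exact_mod_cast this
  have hre := congrArg Complex.re h
  simp only [h10, Int.cast_zero, zero_mul, zero_add, Complex.intCast_re, Complex.zero_re] at hre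
  have hdet : γ 0 0 * γ 1 1 - γ 0 1 * γ 1 0 = 1 := by
    have h' := γ.det_coe; rwa [Matrix.det_fin_two] at h'
  rw [h10, mul_zero, sub_zero] at hdet
  have h11 : (γ 1 1 : ℤ) ≠ 0 := fun h0 => by rw [h0, mul_zero] at hdet; exact zero_ne_one hdet
  exact h11 (by exact_mod_cast hre)

/-- The Möbius action of `SL₂(ℤ)` on `ℍ` in coordinates. [folklore] -/
theorem coe_smul_eq (γ : SL(2, ℤ)) (z : ℍ) :
    ((γ • z : ℍ) : ℂ) = (((γ 0 0 : ℤ) : ℂ) * z + ((γ 0 1 : ℤ) : ℂ)) /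
      (((γ 1 0 : ℤ) : ℂ) * z + ((γ 1 1 : ℤ) : ℂ)) := by
  rw [UpperHalfPlane.coe_specialLinearGroup_apply]
  simp

/-- **`(Q·γ)(z, 1) = (cz + d)² Q(γ • z, 1)` on `ℍ`.** [cite: DukeFriedlanderIwaniec1995, §2 p. 427] -/
theorem evalC_smul (Q : BinQF) (γ : SL(2, ℤ)) (z : ℍ) :
    evalC (smul Q γ) z =
      (((γ 1 0 : ℤ) : ℂ) * z + ((γ 1 1 : ℤ) : ℂ)) ^ 2 * evalC Q ((γ • z : ℍ) : ℂ) := by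
  rw [coe_smul_eq, evalC_smul_of_ne_zero Q γ (denomZ_ne_zero γ z)]

/-- Zeros move contravariantly: `(Q·γ)(z, 1) = 0 ↔ Q(γ • z, 1) = 0`. [cite: DukeFriedlanderIwaniec1995, §2 p. 427] -/
theorem evalC_smul_eq_zero_iff (Q : BinQF) (γ : SL(2, ℤ)) (z : ℍ) :
    evalC (smul Q γ) z = 0 ↔ evalC Q ((γ • z : ℍ) : ℂ) = 0 := by
  rw [evalC_smul, mul_eq_zero, or_iff_right]
  exact pow_ne_zero 2 (denomZ_ne_zero γ z)

/-! ### Negative discriminant: Heegner points -/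

section definite

variable {Q : BinQF}

/-- For `A > 0`, `Δ < 0` the last coefficient is positive (`4AC = B² − Δ > 0`). [folklore] -/
theorem c_pos_of_definite (hA : 0 < Q.a) (hΔ : Q.disc < 0) : 0 < Q.c := by
  rw [BinQF.disc] at hΔ
  nlinarith [sq_nonneg Q.b]

/-- A definite form stays definite with `A > 0` under `SL₂(ℤ)` (the new `A` is a value
`Q(p, r) > 0`). [cite: Cox2013, §2.A] -/
theorem smul_a_pos_of_definite (hA : 0 < Q.a) (hΔ : Q.disc < 0) (γ : SL(2, ℤ)) :
    0 < (smul Q γ).a := by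
  rw [smul_a]
  refine Q.eval_pos hA hΔ ?_
  by_contra h
  push Not at h
  have hdet : γ 0 0 * γ 1 1 - γ 0 1 * γ 1 0 = 1 := by
    have h' := γ.det_coe; rwa [Matrix.det_fin_two] at h'
  rw [h.1, h.2] at hdet
  simp at hdet

/-- **The Heegner point** `z_Q = (−B + i√|Δ|)/(2A) ∈ ℍ` of a form with `A > 0`, `Δ < 0` — DFI's
`π⁻¹(α, β, γ) = (−β + i√D)/α` for `(α, 2β, γ) = (A, B, C)`, `D = −Δ/4`.
[cite: DukeFriedlanderIwaniec1995, §2 p. 427] -/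
def heegnerPt (Q : BinQF) (hA : 0 < Q.a) (hΔ : Q.disc < 0) : ℍ :=
  ⟨(-(Q.b : ℂ) + Complex.I * (Real.sqrt (-(Q.disc : ℝ)) : ℂ)) / ((2 * Q.a : ℝ) : ℂ), by
    rw [Complex.div_ofReal_im]
    have h1 : (-(Q.b : ℂ) + Complex.I * (Real.sqrt (-(Q.disc : ℝ)) : ℂ)).im = Real.sqrt (-(Q.disc : ℝ)) := by
      simp
    rw [h1]
    have hs : 0 < Real.sqrt (-(Q.disc : ℝ)) := Real.sqrt_pos.2 (by exact_mod_cast neg_pos.2 hΔ)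
    have h2 : (0 : ℝ) < 2 * Q.a := by exact_mod_cast mul_pos two_pos hA
    exact div_pos hs h2⟩

/-- The Heegner point in coordinates. [folklore] -/
theorem coe_heegnerPt (hA : 0 < Q.a) (hΔ : Q.disc < 0) :
    ((heegnerPt Q hA hΔ : ℍ) : ℂ) =
      (-(Q.b : ℂ) + Complex.I * (Real.sqrt (-(Q.disc : ℝ)) : ℂ)) / ((2 * Q.a : ℝ) : ℂ) := rfl

/-- `Q(z_Q, 1) = 0`. [cite: DukeFriedlanderIwaniec1995, §2 p. 427] -/
theorem evalC_heegnerPt (hA : 0 < Q.a) (hΔ : Q.disc < 0) :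
    evalC Q ((heegnerPt Q hA hΔ : ℍ) : ℂ) = 0 := by
  rw [coe_heegnerPt, evalC]
  set s : ℝ := Real.sqrt (-(Q.disc : ℝ)) with hs
  have hs2 : (s : ℂ) ^ 2 = -((Q.disc : ℤ) : ℂ) := by
    have h : s ^ 2 = -(Q.disc : ℝ) := Real.sq_sqrt (by exact_mod_cast (neg_pos.2 hΔ).le)
    have h2 := congrArg (fun r : ℝ => (r : ℂ)) h
    push_cast at h2
    exact h2
  have hA' : ((2 * Q.a : ℝ) : ℂ) ≠ 0 := by
    have : (2 * Q.a : ℝ) ≠ 0 := by exact_mod_cast (mul_pos two_pos hA).ne'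
    exact_mod_cast Complex.ofReal_ne_zero.2 this
  have hI := Complex.I_sq
  rw [BinQF.disc] at hs2
  push_cast at hs2
  field_simp
  push_cast
  linear_combination (-(Q.a : ℂ)) * hs2 + ((Q.a : ℂ) * (s : ℂ) ^ 2) * hI

/-- **Uniqueness**: the only zero of `Q(z, 1)` in the upper half-plane is `z_Q` (`A > 0`,
`Δ < 0`; the other root `(−B − i√|Δ|)/(2A)` lies in the lower half-plane).
[cite: DukeFriedlanderIwaniec1995, §2 p. 427 ("one-to-one correspondence")] -/
theorem eq_heegnerPt_of_evalC_eq_zero (hA : 0 < Q.a) (hΔ : Q.disc < 0) {z : ℂ}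
    (hz : evalC Q z = 0) (him : 0 < z.im) : z = ((heegnerPt Q hA hΔ : ℍ) : ℂ) := by
  rw [coe_heegnerPt]
  set s : ℝ := Real.sqrt (-(Q.disc : ℝ)) with hs
  have hs0 : 0 < s := Real.sqrt_pos.2 (by exact_mod_cast neg_pos.2 hΔ)
  have hs2 : (s : ℂ) ^ 2 = -((Q.disc : ℤ) : ℂ) := by
    have h : s ^ 2 = -(Q.disc : ℝ) := Real.sq_sqrt (by exact_mod_cast (neg_pos.2 hΔ).le)
    have h2 := congrArg (fun r : ℝ => (r : ℂ)) h
    push_cast at h2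
    exact h2
  -- `(2Az + B)² = (is)²`
  have hsq : (2 * (Q.a : ℂ) * z + Q.b) ^ 2 = (Complex.I * s) ^ 2 := by
    rw [mul_pow, Complex.I_sq, hs2, BinQF.disc]
    rw [evalC] at hz
    push_cast
    linear_combination (4 * (Q.a : ℂ)) * hz
  rcases (sq_eq_sq_iff_eq_or_eq_neg.1 hsq) with h | h
  · -- the root in `ℍ`
    have hA' : ((2 * Q.a : ℝ) : ℂ) ≠ 0 := by
      have : (2 * Q.a : ℝ) ≠ 0 := by exact_mod_cast (mul_pos two_pos hA).ne'
      exact_mod_cast Complex.ofReal_ne_zero.2 this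
    field_simp
    push_cast
    linear_combination h
  · -- the other root has negative imaginary part
    exfalso
    have him' := congrArg Complex.im h
    simp only [Complex.add_im, Complex.mul_im, Complex.mul_re, Complex.re_ofNat, Complex.im_ofNat,
      Complex.intCast_re, Complex.intCast_im, Complex.neg_im, Complex.I_re, Complex.I_im,
      Complex.ofReal_re, Complex.ofReal_im, mul_zero, zero_mul, add_zero, sub_zero, zero_add,
      one_mul] at him'
    -- `2A · Im z = −s < 0`
    have hA' : (0 : ℝ) < (Q.a : ℝ) := by exact_mod_cast hA
    nlinarith [mul_pos hA' him]

/-- **Equivariance of Heegner points**: `z_{Q·γ} = γ⁻¹ • z_Q` (DFI: `π ∘ σ = σ ∘ π`; with the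
right action on forms the point moves by `γ⁻¹`). [cite: DukeFriedlanderIwaniec1995, §2 p. 427] -/
theorem heegnerPt_smul (hA : 0 < Q.a) (hΔ : Q.disc < 0) (γ : SL(2, ℤ)) :
    heegnerPt (smul Q γ) (smul_a_pos_of_definite hA hΔ γ) (by rwa [smul_disc]) =
      γ⁻¹ • heegnerPt Q hA hΔ := by
  apply UpperHalfPlane.ext
  symm
  refine eq_heegnerPt_of_evalC_eq_zero _ _ ?_ (γ⁻¹ • heegnerPt Q hA hΔ).im_pos
  rw [evalC_smul_eq_zero_iff, smul_inv_smul]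
  exact evalC_heegnerPt hA hΔ

/-- A stabiliser element fixes the Heegner point. [cite: DukeFriedlanderIwaniec1995, §2 p. 427 (`Γ_z`)] -/
theorem smul_heegnerPt_of_mem_stab (hA : 0 < Q.a) (hΔ : Q.disc < 0) {s : SL(2, ℤ)}
    (hs : s ∈ stab Q) : s • heegnerPt Q hA hΔ = heegnerPt Q hA hΔ := by
  have h := heegnerPt_smul hA hΔ s⁻¹
  simp only [inv_inv] at h
  rw [← h]
  congr 1
  exact mem_stab_iff.1 (Subgroup.inv_mem _ hs)

/-- `4C·Q(x, y) = (Bx + 2Cy)² − Δx²`. [cite: Cox2013, §2.A] -/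
theorem four_mul_c_mul_eval (Q : BinQF) (x y : ℤ) :
    4 * Q.c * Q.eval x y = (Q.b * x + 2 * Q.c * y) ^ 2 - Q.disc * x ^ 2 := by
  simp only [BinQF.eval, BinQF.disc]; ring

/-- For a definite form the representations `Q(x, y) = m` have `|Δ| y² ≤ 4Am` and `|Δ| x² ≤ 4Cm`.
[cite: Cox2013, §2.A] -/
theorem sq_le_of_eval_eq (hA : 0 < Q.a) (hΔ : Q.disc < 0) {x y m : ℤ} (h : Q.eval x y = m) :
    y ^ 2 ≤ 4 * Q.a * m ∧ x ^ 2 ≤ 4 * Q.c * m := by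
  have hC := c_pos_of_definite hA hΔ
  have h1 := Q.four_mul_a_mul_eval x y
  have h2 := four_mul_c_mul_eval Q x y
  rw [h] at h1 h2
  have hΔ1 : Q.disc ≤ -1 := by omega
  constructor
  · nlinarith [sq_nonneg (2 * Q.a * x + Q.b * y), sq_nonneg y]
  · nlinarith [sq_nonneg (Q.b * x + 2 * Q.c * y), sq_nonneg x]

/-- **The stabiliser of a definite form is finite** (its columns represent `A` and `C`, which a
positive definite form does only finitely often) — DFI's finite stability groups `Γ_z`.
[cite: DukeFriedlanderIwaniec1995, §2 pp. 427–428 (`|Γ_z|`)] -/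
theorem finite_stab_of_definite (hA : 0 < Q.a) (hΔ : Q.disc < 0) : Finite (stab Q) := by
  have hC := c_pos_of_definite hA hΔ
  set K : ℤ := 4 * (Q.a + Q.c) * (Q.a + Q.c) with hK
  -- every entry of a stabilising matrix is bounded by `K` in absolute value (crudely)
  have hbound : ∀ s : SL(2, ℤ), s ∈ stab Q → ∀ i j : Fin 2, (s i j) ∈ Set.Icc (-K) K := by
    intro s hs i j
    have hQs := mem_stab_iff.1 hs
    -- first column represents `A`, second column represents `C`
    have hcol0 : Q.eval (s 0 0) (s 1 0) = Q.a := by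
      have := congrArg BinQF.a hQs; rwa [smul_a] at this
    have hcol1 : Q.eval (s 0 1) (s 1 1) = Q.c := congrArg BinQF.c hQs
    obtain ⟨h10, h00⟩ := sq_le_of_eval_eq hA hΔ hcol0
    obtain ⟨h11, h01⟩ := sq_le_of_eval_eq hA hΔ hcol1
    have key : ∀ t : ℤ, t ^ 2 ≤ K → t ∈ Set.Icc (-K) K := by
      intro t ht
      have hK1 : 1 ≤ K := by rw [hK]; nlinarith
      constructor <;> nlinarith [sq_nonneg t, sq_nonneg (t - 1), sq_nonneg (t + 1)]
    have hKa : 4 * Q.a * Q.a ≤ K := by rw [hK]; nlinarith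
    have hKc : 4 * Q.c * Q.a ≤ K := by rw [hK]; nlinarith
    have hKa' : 4 * Q.a * Q.c ≤ K := by rw [hK]; nlinarith
    have hKc' : 4 * Q.c * Q.c ≤ K := by rw [hK]; nlinarith
    fin_cases i <;> fin_cases j
    · exact key _ (h00.trans hKc)
    · exact key _ (h01.trans hKc')
    · exact key _ (h10.trans hKa)
    · exact key _ (h11.trans hKa')
  let f : stab Q → (Fin 2 → Fin 2 → Set.Icc (-K) K) :=
    fun s i j => ⟨(s : SL(2, ℤ)) i j, hbound s s.2 i j⟩
  refine Finite.of_injective f fun s s' h => ?_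
  apply Subtype.ext
  ext i j
  have := congrFun (congrFun h i) j
  exact congrArg Subtype.val this

end definite

/-! ### Positive discriminant: geodesics -/

section indefinite

variable {Q : BinQF}

/-- The Hermitian height `herm Q z = A|z|² + B Re z + C` whose zero set in `ℍ` is the geodesic of an
indefinite form. [cite: Toth2000, main theorem (the closed geodesics of the positive-discriminant case; cf. Ngo2024 §1)] -/
def herm (Q : BinQF) (z : ℂ) : ℝ := Q.a * Complex.normSq z + Q.b * z.re + Q.c

/-- **`herm (Q·γ) z = |cz + d|² · herm Q (γz)`** for `cz + d ≠ 0`: the zero sets move by `γ⁻¹`.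
[cite: DukeFriedlanderIwaniec1995, §2 p. 427 ("these actions commute"; here for the Hermitian form)] -/
theorem herm_smul_of_ne_zero (Q : BinQF) (γ : SL(2, ℤ)) {z : ℂ}
    (hd : ((γ 1 0 : ℤ) : ℂ) * z + ((γ 1 1 : ℤ) : ℂ) ≠ 0) :
    herm (smul Q γ) z = Complex.normSq (((γ 1 0 : ℤ) : ℂ) * z + ((γ 1 1 : ℤ) : ℂ)) *
      herm Q ((((γ 0 0 : ℤ) : ℂ) * z + ((γ 0 1 : ℤ) : ℂ)) /
        (((γ 1 0 : ℤ) : ℂ) * z + ((γ 1 1 : ℤ) : ℂ))) := by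
  have hn : Complex.normSq (((γ 1 0 : ℤ) : ℂ) * z + ((γ 1 1 : ℤ) : ℂ)) ≠ 0 :=
    (Complex.normSq_pos.2 hd).ne'
  simp only [herm, Complex.normSq_div, Complex.div_re, smul, BinQF.act]
  push_cast
  field_simp
  simp only [Complex.normSq_apply, Complex.add_re, Complex.mul_re, Complex.add_im, Complex.mul_im,
    Complex.intCast_re, Complex.intCast_im]
  ring

/-- **`herm (Q·γ) z = |cz + d|² herm Q (γ • z)` on `ℍ`.** [cite: DukeFriedlanderIwaniec1995, §2 p. 427] -/
theorem herm_smul (Q : BinQF) (γ : SL(2, ℤ)) (z : ℍ) :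
    herm (smul Q γ) z =
      Complex.normSq (((γ 1 0 : ℤ) : ℂ) * z + ((γ 1 1 : ℤ) : ℂ)) * herm Q ((γ • z : ℍ) : ℂ) := by
  rw [coe_smul_eq, herm_smul_of_ne_zero Q γ (denomZ_ne_zero γ z)]

/-- The geodesic `S_Q = {z ∈ ℍ : A|z|² + B Re z + C = 0}` of a form (for `Δ > 0`, `A ≠ 0` the
semicircle on the segment between the real roots of `Q(x, 1)`).
[cite: Toth2000, main theorem (closed geodesics; cf. Ngo2024 §1)] -/
def geod (Q : BinQF) : Set ℍ := {z | herm Q z = 0}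

/-- Membership in `geod`. [folklore] -/
theorem mem_geod {z : ℍ} : z ∈ geod Q ↔ herm Q z = 0 := Iff.rfl

/-- **Equivariance of geodesics**: `z ∈ S_{Q·γ} ↔ γ • z ∈ S_Q`, i.e. `S_{Q·γ} = γ⁻¹ S_Q`.
[cite: DukeFriedlanderIwaniec1995, §2 p. 427 (equivariance), applied to indefinite forms] -/
theorem mem_geod_smul_iff (Q : BinQF) (γ : SL(2, ℤ)) (z : ℍ) :
    z ∈ geod (smul Q γ) ↔ γ • z ∈ geod Q := by
  rw [mem_geod, mem_geod, herm_smul, mul_eq_zero, or_iff_right]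
  exact (Complex.normSq_pos.2 (denomZ_ne_zero γ z)).ne'

/-- The geodesic of `Q·γ` is the `γ⁻¹`-translate of that of `Q`. [folklore] -/
theorem geod_smul (Q : BinQF) (γ : SL(2, ℤ)) : geod (smul Q γ) = (fun z : ℍ => γ • z) ⁻¹' geod Q := by
  ext z
  exact mem_geod_smul_iff Q γ z

/-- A stabiliser element preserves the geodesic. [folklore] -/
theorem smul_mem_geod_of_mem_stab {s : SL(2, ℤ)} (hs : s ∈ stab Q) {z : ℍ} (hz : z ∈ geod Q) :
    s • z ∈ geod Q := by
  rw [← mem_geod_smul_iff, mem_stab_iff.1 hs]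
  exact hz

/-- **The geodesic is a semicircle**: for `A ≠ 0`,
`herm Q z = A · ((Re z + B/(2A))² + (Im z)² − Δ/(4A²))`. [folklore] -/
theorem herm_eq_mul (hA : Q.a ≠ 0) (z : ℂ) :
    herm Q z = Q.a * ((z.re + Q.b / (2 * Q.a)) ^ 2 + z.im ^ 2 - Q.disc / (4 * (Q.a : ℝ) ^ 2)) := by
  have hA' : (Q.a : ℝ) ≠ 0 := by exact_mod_cast hA
  rw [herm, Complex.normSq_apply, BinQF.disc]
  push_cast
  field_simp
  ring

/-- Membership in the geodesic as the semicircle equation `(x + B/2A)² + y² = Δ/(4A²)` (centre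
`−B/(2A)` on the real axis, radius `√Δ/(2|A|)` when `Δ > 0`). [cite: Toth2000, main theorem (closed geodesics; cf. Ngo2024 §1)] -/
theorem mem_geod_iff (hA : Q.a ≠ 0) {z : ℍ} :
    z ∈ geod Q ↔ ((z : ℂ).re + Q.b / (2 * Q.a)) ^ 2 + (z : ℂ).im ^ 2 = Q.disc / (4 * (Q.a : ℝ) ^ 2) := by
  have hA' : (Q.a : ℝ) ≠ 0 := by exact_mod_cast hA
  rw [mem_geod, herm_eq_mul hA, mul_eq_zero, or_iff_right hA', sub_eq_zero]

/-- For `Δ ≤ 0` and `A ≠ 0` the "geodesic" is empty (no `z ∈ ℍ` on a circle of non-positive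
squared radius); the construction is meaningful exactly in Tóth's case `Δ > 0`. [folklore] -/
theorem geod_eq_empty_of_disc_nonpos (hA : Q.a ≠ 0) (hΔ : Q.disc ≤ 0) : geod Q = ∅ := by
  ext z
  simp only [Set.mem_empty_iff_false, iff_false]
  rw [mem_geod_iff hA]
  intro h
  have hy : (0 : ℝ) < (z : ℂ).im ^ 2 := by
    have := z.im_pos
    rw [← UpperHalfPlane.coe_im] at this
    positivity
  have hr : (Q.disc : ℝ) / (4 * (Q.a : ℝ) ^ 2) ≤ 0 :=
    div_nonpos_of_nonpos_of_nonneg (by exact_mod_cast hΔ) (by positivity)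
  nlinarith [sq_nonneg ((z : ℂ).re + Q.b / (2 * Q.a))]

/-! ### Positive discriminant: automorphs and the infinite stabiliser -/

/-- **The automorph of a Pell solution**: for `x² − Δy² = 1`,
`U(x, y) = (x − By, −2Cy; 2Ay, x + By) ∈ SL₂(ℤ)` (`= x·1 + y·M`, `M = (−B, −2C; 2A, B)`,
`M² = Δ·1`); classical (Pell), verified here by computation. [folklore] -/
def automorph (Q : BinQF) (a : Pell.Solution₁ Q.disc) : SL(2, ℤ) :=
  ⟨!![a.x - Q.b * a.y, -(2 * Q.c * a.y); 2 * Q.a * a.y, a.x + Q.b * a.y], by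
    rw [Matrix.det_fin_two_of]
    have h := a.prop
    have hd : Q.disc = Q.b ^ 2 - 4 * Q.a * Q.c := rfl
    linear_combination h + a.y ^ 2 * hd⟩

/-- Entries of the automorph. [folklore] -/
@[simp] theorem automorph_apply_00 (a : Pell.Solution₁ Q.disc) : automorph Q a 0 0 = a.x - Q.b * a.y := rfl

/-- Entries of the automorph. [folklore] -/
@[simp] theorem automorph_apply_01 (a : Pell.Solution₁ Q.disc) : automorph Q a 0 1 = -(2 * Q.c * a.y) := rfl

/-- Entries of the automorph. [folklore] -/
@[simp] theorem automorph_apply_10 (a : Pell.Solution₁ Q.disc) : automorph Q a 1 0 = 2 * Q.a * a.y := rfl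

/-- Entries of the automorph. [folklore] -/
@[simp] theorem automorph_apply_11 (a : Pell.Solution₁ Q.disc) : automorph Q a 1 1 = a.x + Q.b * a.y := rfl

/-- **Automorphs stabilise the form**: `Q·U(x, y) = Q` (classical; by computation). [folklore] -/
theorem smul_automorph (Q : BinQF) (a : Pell.Solution₁ Q.disc) : smul Q (automorph Q a) = Q := by
  have h := a.prop
  have hd : Q.disc = Q.b ^ 2 - 4 * Q.a * Q.c := rfl
  simp only [smul, automorph_apply_00, automorph_apply_01, automorph_apply_10, automorph_apply_11,
    BinQF.act]
  ext
  · linear_combination Q.a * h + Q.a * a.y ^ 2 * hd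
  · linear_combination Q.b * h + Q.b * a.y ^ 2 * hd
  · linear_combination Q.c * h + Q.c * a.y ^ 2 * hd

/-- `U(x, y) ∈ stab Q`. [folklore] -/
theorem automorph_mem_stab (Q : BinQF) (a : Pell.Solution₁ Q.disc) : automorph Q a ∈ stab Q :=
  smul_automorph Q a

/-- **`(x, y) ↦ U(x, y)` is a group homomorphism** `Pell.Solution₁ Δ →* SL₂(ℤ)` (it is the
regular representation of `x + y√Δ` on `ℤ·1 ⊕ ℤ·M`, `M² = Δ`). [folklore] -/
def automorphHom (Q : BinQF) : Pell.Solution₁ Q.disc →* SL(2, ℤ) where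
  toFun := automorph Q
  map_one' := by
    ext i j
    fin_cases i <;> fin_cases j <;> simp [automorph, Pell.Solution₁.x_one, Pell.Solution₁.y_one]
  map_mul' a b := by
    ext i j
    have hd : Q.disc = Q.b ^ 2 - 4 * Q.a * Q.c := rfl
    fin_cases i <;> fin_cases j <;>
      simp [automorph, Matrix.mul_apply, Fin.sum_univ_two, Pell.Solution₁.x_mul,
        Pell.Solution₁.y_mul, hd] <;> ring

/-- `automorphHom Q a = automorph Q a`. [folklore] -/
@[simp] theorem automorphHom_apply (Q : BinQF) (a : Pell.Solution₁ Q.disc) :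
    automorphHom Q a = automorph Q a := rfl

/-- The automorph map is injective when `A ≠ 0` (read off `y` from the lower-left entry `2Ay`,
then `x`). [folklore] -/
theorem automorph_injective (hA : Q.a ≠ 0) : Function.Injective (automorph Q) := by
  intro a b h
  have h10 := congrArg (fun g : SL(2, ℤ) => g 1 0) h
  have h00 := congrArg (fun g : SL(2, ℤ) => g 0 0) h
  simp only [automorph_apply_10, automorph_apply_00] at h10 h00
  have hy : a.y = b.y := by
    have : (2 * Q.a) * a.y = (2 * Q.a) * b.y := by linarith
    exact mul_left_cancel₀ (by positivity) this
  have hx : a.x = b.x := by rw [hy] at h00; linarith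
  exact Pell.Solution₁.ext hx hy

/-- For non-square `Δ > 0` the Pell solutions form an infinite group (powers of a solution with
`y ≠ 0` are distinct). [folklore] -/
theorem infinite_pellSolution {d : ℤ} (h₀ : 0 < d) (hd : ¬ IsSquare d) : Infinite (Pell.Solution₁ d) := by
  obtain ⟨a, hax, hay⟩ := Pell.Solution₁.exists_pos_of_not_isSquare h₀ hd
  have hno : ¬ IsOfFinOrder a := by
    intro hfin
    obtain ⟨n, hn, h1⟩ := hfin.exists_pow_eq_one
    obtain ⟨m, rfl⟩ : ∃ m, n = m + 1 := ⟨n - 1, by omega⟩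
    have hy := Pell.Solution₁.y_pow_succ_pos (by linarith) hay m
    rw [h1, Pell.Solution₁.y_one] at hy
    exact lt_irrefl _ hy
  exact Infinite.of_injective (fun n : ℕ => a ^ n) (injective_pow_iff_not_isOfFinOrder.2 hno)

/-- **The stabiliser of a form of non-square positive discriminant is infinite** (it contains the
automorphs of all Pell solutions) — the hyperbolic / closed-geodesic structure of Tóth's case, in
contrast with the finite `Γ_z` of DFI's. [cite: Toth2000, main theorem (positive discriminant; cf. Ngo2024 §1)] -/
theorem infinite_stab_of_pos (hΔ : 0 < Q.disc) (hsq : ¬ IsSquare Q.disc) : Infinite (stab Q) := by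
  haveI := infinite_pellSolution hΔ hsq
  have hA : Q.a ≠ 0 := a_ne_zero_of_not_isSquare hsq
  exact Infinite.of_injective (fun a : Pell.Solution₁ Q.disc => (⟨automorph Q a, automorph_mem_stab Q a⟩ : stab Q))
    (fun a b h => automorph_injective hA (congrArg Subtype.val h))

end indefinite

end RootForms

end Literature.NumberTheory.Sieve
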